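import Literature.NumberTheory.LFunctions.WeilFirstPrimeCertificateCCheck
import Literature.NumberTheory.LFunctions.WeilFirstPrimeQuadratic
import Literature.NumberTheory.LFunctions.WeilSharpConstants
import HarnessLib

/-!
# First-prime Weil positivity on the cone `C((log 3)/2)` (Yoshida's first rung)

Topic: `Literature/NumberTheory/LFunctions`. **`WeilPositivityOn (Real.log 3 / 2)`**:
`Re W(g ⋆ g̃) ≥ 0` for every Weil test function `g` with `tsupport g ⊆ [−(log 3)/2, (log 3)/2]`,
from the kernel-checked Stage-C certificate `weilCert3C` (`a₀ = b = 563/1024 ≥ (log 3)/2`) and the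
soundness theorem `WeilCert3.weilFirstPrimeQuadratic_nonneg_of_check`.

## References

* H. Yoshida, *On Hermitian forms attached to zeta functions*, Adv. Stud. Pure Math. 21 (1992),
  Theorem 1 (p. 310), §6. [Yoshida1992]
-/

noncomputable section

open Set

namespace Literature.NumberTheory.LFunctions

/-- `(log 3)/2 ≤ weilCert3C.b` (`log 3 ≤ logThreeHiQ ≤ 2b`). [folklore] -/
theorem log_three_half_le_certb : Real.log 3 / 2 ≤ ((weilCert3C.b : ℚ) : ℝ) := by
  have h := logThree_le
  have h2 : logThreeHiQ ≤ 2 * weilCert3C.b := by decide +kernel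
  have h3 : ((logThreeHiQ : ℚ) : ℝ) ≤ 2 * ((weilCert3C.b : ℚ) : ℝ) := by exact_mod_cast h2
  linarith

/-- **`E₂ ≥ 0` on `C((log 3)/2)`** (kernel-checked Stage-C certificate). [cite: Yoshida1992, Thm 1 (p. 310), §6 (method); certificate new] -/
theorem weilFirstPrimeQuadratic_nonneg_of_tsupport_subset_log_three_half {g : ℝ → ℂ}
    (hg : IsWeilTest g) (hsupp : tsupport g ⊆ Icc (-(Real.log 3 / 2)) (Real.log 3 / 2)) :
    0 ≤ weilFirstPrimeQuadratic g := by
  have hb : tsupport g ⊆ Icc (-((weilCert3C.b : ℚ) : ℝ)) ((weilCert3C.b : ℚ) : ℝ) :=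
    hsupp.trans (Icc_subset_Icc (by linarith [log_three_half_le_certb]) log_three_half_le_certb)
  exact WeilCert3.weilFirstPrimeQuadratic_nonneg_of_check check_weilCert3C hg hb

/-- **Weil positivity on the cone `C((log 3)/2)`** — first-prime Weil positivity (Yoshida's rung,
with the prime `2` in the support). [cite: Yoshida1992, Thm 1 (p. 310) (there for a = (log 3)/2 − 10⁻⁵ in floating point); certificate new] -/
theorem weilPositivityOn_log_three_half : WeilPositivityOn (Real.log 3 / 2) :=
  weilPositivityOn_log_three_half_of_weilFirstPrimeQuadratic_nonneg
    fun _ hg hsupp ↦ weilFirstPrimeQuadratic_nonneg_of_tsupport_subset_log_three_half hg hsupp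

end Literature.NumberTheory.LFunctions
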